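import Mathlib
import Literature.Computability.AlgebraicComplexity.FSV2018ROABP
import HarnessLib

/-!
# Forbes–Shpilka 2013, §3.2: "the recursive structure" (arXiv Lemma 17), the degree in the last
# seed (arXiv Lemma 16, second bullet) of the generator — for FSV 2018's explicit form (7.1)
# (`fsGenCoord`) — and the binary split `𝓜 = 𝓜₀ · 𝓜₁` of the layer product; proofs, no named facts

M. A. Forbes, A. Shpilka, *Quasipolynomial-time identity testing of non-commutative and read-once
oblivious algebraic branching programs*, FOCS 2013 = arXiv:1209.2408 [ForbesShpilka2013], §3.2,
Construction 3.13 (arXiv: Construction 15) and the lemma "The recursive structure" (arXiv Lemma 17,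
paper:arxiv-1209.2408 p0015.txt:L50–L58):

> `𝒢_{d, b⃗ b_{d-1}}(α⃗, α_{d-1}, α_d) = Σ_{ℓ_{d-1} ∈ ⟦r²⟧} 𝒢_{d-1, b⃗}(α⃗, ω^{ℓ_{d-1}} α_{d-1}) p_{ℓ_{d-1}}(α_d)`
> if `b_{d-1} = 0`, and `… 𝒢_{d-1, b⃗}(α⃗, (ω^{ℓ_{d-1}} α_{d-1})^{D n r²/2}) p_{ℓ_{d-1}}(α_d)` else
> ("This claim follows from the definitions, with some rearrangement of terms").

Typed for the tree's rendering of FSV 2018 eq. (7.1), `fsGenCoord n w d ω β` (`FSV2018ROABP.lean`;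
FSV's parameters: `n+1` seeds `y_0, …, y_n`, `N = 2ⁿ` outputs indexed by multilinear exponent
vectors, width `w`, `p_ℓ` = `fsBasis β`, twist `ω^{ℓ+1}`, exponent `2^i d w²` at seed `i`): peeling
the LAST bit `c = m'(n)` of `m' ∈ {0,1}^{n+1}`,
`𝒢^{(n+1)}_{m'}(y_0..y_n, y_{n+1}) = Σ_{k<w²} σ_k(𝒢^{(n)}_{m'|n})(y) · p_k(y_{n+1})`, where `σ_k`
substitutes `y_n ↦ ω^{k+1} y_n` (`c = 0`) resp. `y_n ↦ (ω^{k+1} y_n)^{2ⁿ d w²}` (`c = 1`) and keeps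
`y_j`, `j < n` (`fsGenCoord_succ`; base `fsGenCoord_zero`). This is the structural identity through
which [FS13, Lemma 3.19 (arXiv 19)] (span preservation, induction on `n`) consumes the merging
Lemma 3.6 (`FS2013.span_evalProd_le_span_of_nodes`, `FS13SpanDimensionReduction.lean`). Also
arXiv Lemma 16 ("Bounding the degree"), second bullet — "for `i = d`, `deg_{α_d}(𝒢_{d,b}) ≤ r²`":
`degreeOf_last_fsGenCoord_le` (the degree bound `m = r²` on the curves with which Lemma 3.6 is
applied in that induction). And the split "`𝓜 = 𝓜₀ · 𝓜₁`" of the `2^{n+1}` layers in FSV's order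
`X_1, …, X_N` (`binaryOrder`): the first `2ⁿ` variables are the `X_{(b,0)}`, the last `2ⁿ` the
`X_{(b,1)}` (`binaryOrder_succ_lower/upper(_last)`, `listProd_ofFn_two_pow_succ`). And the
evaluated form of the recursion at the Lagrange nodes `y_{n+1} = β_ℓ` (distinct `β`):
`𝒢^{(n+1)}_{m'}(α', a, β_ℓ) = 𝒢^{(n)}_m(α', ω^{ℓ+1} a)` resp. `𝒢^{(n)}_m(α', (ω^{ℓ+1} a)^{2ⁿ d w²})`
(`eval_fsGenCoord_succ_node`; "`U(β_ℓ) = R(ω^ℓ α̂)`" in the merging step of Lemma 3.19's proof).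
Finally the curve/layer tools of that induction: the last seed as a curve parameter
(`eval_aeval_snoc_C_X`, `natDegree_aeval_snoc_C_X_le`, `natDegree_fsGenCoord_lastCurve_le`:
"`f ∈ 𝔽[α_{d-1}]` of degree `≤ r²`"), degrees and images of ordered layer products
(`natDegree_listProd_ofFn_le`: "`R` of degree `< Dnm`"; `map_listProd_ofFn`, `map_comp_map_eval`,
`natDegree_map_comp_le`). A step towards the named fact `ForbesShpilkaVolk2018_lemma55` (safe
reading); nothing here bears on `VP ≠ VNP`.

## References
* [ForbesShpilka2013] arXiv:1209.2408 §3.2, Construction 15 / Lemma 16 / Lemma 17 (arXiv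
  numbering) (locator: paper:arxiv-1209.2408 p0015.txt:L19–L58).
* [ForbesShpilkaVolk2018] Lemma 55, eq. (7.1) (seq.; = ToC Lemma 7.1) — the typed formula.
-/

noncomputable section

open MvPolynomial Finset

open scoped BigOperators

namespace Literature.Computability.AlgebraicComplexity

namespace FS2013

variable {F : Type*} [Field F] {n w : ℕ}

/-- The basis index of layer `i` is unchanged when a last twist index is appended:
`fsIdx (snoc ℓ k) i.castSucc = fsIdx ℓ i`. [cite: ForbesShpilka2013, Lemma 17 (arXiv), proof
("rearrangement of terms")] locator: paper:arxiv-1209.2408 p0015.txt:L52–L56 -/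
theorem fsIdx_snoc_castSucc (ℓ : Fin n → Fin (w ^ 2)) (k : Fin (w ^ 2)) (i : Fin (n + 1)) :
    fsIdx (Fin.snoc ℓ k : Fin (n + 1) → Fin (w ^ 2)) i.castSucc = fsIdx ℓ i := by
  unfold fsIdx
  refine Fin.cases ?_ (fun j => ?_) i
  · rfl
  · rw [← Fin.succ_castSucc, Fin.cons_succ, Fin.cons_succ, Fin.snoc_castSucc]

/-- The last layer of level `n+1` uses `p_k`, `k` the appended index:
`fsIdx (snoc ℓ k) (last (n+1)) = some k`. [cite: ForbesShpilka2013, Lemma 17 (arXiv), proof]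
locator: paper:arxiv-1209.2408 p0015.txt:L52–L56 -/
theorem fsIdx_snoc_last (ℓ : Fin n → Fin (w ^ 2)) (k : Fin (w ^ 2)) :
    fsIdx (Fin.snoc ℓ k : Fin (n + 1) → Fin (w ^ 2)) (Fin.last (n + 1)) = some k := by
  unfold fsIdx
  rw [← Fin.succ_last, Fin.cons_succ, Fin.snoc_last]

/-- The substitution `σ_k^{(c)}` of the recursion: `y_j ↦ y_j` (`j < n`) and `y_n ↦ ω^{k+1} y_n`
(`c = 0`) resp. `y_n ↦ (ω^{k+1} y_n)^{2ⁿ d w²}` (`c ≠ 0`), into the seeds `y_0, …, y_{n+1}` of the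
next level. Written inline in `fsGenCoord_succ`; this lemma records its values on variables.
[cite: ForbesShpilka2013, Lemma 17 (arXiv)] locator: paper:arxiv-1209.2408 p0015.txt:L50–L51 -/
theorem aeval_snoc_X_castSucc (q : MvPolynomial (Fin (n + 2)) F) (j : Fin n) :
    MvPolynomial.aeval (R := F)
        (Fin.snoc (fun j : Fin n => (X j.castSucc.castSucc : MvPolynomial (Fin (n + 2)) F)) q)
        (X j.castSucc : MvPolynomial (Fin (n + 1)) F) = X j.castSucc.castSucc := by
  rw [MvPolynomial.aeval_X, Fin.snoc_castSucc]

/-- **Base of the recursion:** with no `x`-seeds the generator is the identity in the one seed,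
`𝒢_{0,∅}(α_0) = p_{ℓ_{-1}}(α_0) = α_0` ([FS13, arXiv eq. after Construction 15]); for FSV's (7.1):
`fsGenCoord 0 w d ω β m = y_0`. [cite: ForbesShpilka2013, Construction 15 (arXiv numbering; §3.2 Construction 3.13), second display]
locator: paper:arxiv-1209.2408 p0015.txt:L27–L29 -/
theorem fsGenCoord_zero (w d : ℕ) (ω : F) (β : Fin (w ^ 2) → F) (m : multilinearMonomials 0) :
    fsGenCoord 0 w d ω β m = X 0 := by
  unfold fsGenCoord
  rw [Fintype.sum_unique]
  simp only [Finset.univ_eq_empty, Finset.prod_empty, one_mul]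
  unfold fsIdx
  rw [show (Fin.last 0 : Fin 1) = 0 from rfl, Fin.cons_zero]
  show Polynomial.aeval (X 0) (fsBasis β none) = X 0
  unfold fsBasis
  exact Polynomial.aeval_X _

/-- **[ForbesShpilka2013, arXiv Lemma 17 "The recursive structure"] for FSV's (7.1):** for
`m' ∈ {0,1}^{n+1}` with restriction `m = m'|_{<n}` and last bit `c = m'(n)`,
`𝒢^{(n+1)}_{m'} = Σ_{k<w²} σ_k^{(c)}(𝒢^{(n)}_m) · p_k(y_{n+1})`.
[cite: ForbesShpilka2013, Lemma 17 (arXiv numbering; §3.2); ForbesShpilkaVolk2018, Lemma 55 eq. (7.1)]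
locator: paper:arxiv-1209.2408 p0015.txt:L50–L58 -/
theorem fsGenCoord_succ (n w d : ℕ) (ω : F) (β : Fin (w ^ 2) → F)
    (m' : multilinearMonomials (n + 1)) (m : multilinearMonomials n)
    (hm : ∀ i : Fin n, (m : Fin n →₀ ℕ) i = (m' : Fin (n + 1) →₀ ℕ) i.castSucc) :
    fsGenCoord n.succ w d ω β m' =
      ∑ k : Fin (w ^ 2),
        MvPolynomial.aeval
            (Fin.snoc (fun j : Fin n => (X j.castSucc.castSucc : MvPolynomial (Fin (n + 2)) F))
              (if (m' : Fin (n + 1) →₀ ℕ) (Fin.last n) = 0 then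
                  C (ω ^ ((k : ℕ) + 1)) * X (Fin.last n).castSucc
               else (C (ω ^ ((k : ℕ) + 1)) * X (Fin.last n).castSucc) ^ (2 ^ n * d * w ^ 2)))
          (fsGenCoord n w d ω β m) *
        Polynomial.aeval (X (Fin.last (n + 1))) (fsBasis β (some k)) := by
  classical
  unfold fsGenCoord
  -- reindex the sum over `ℓ : Fin (n+1) → [w²]` by `(k, ℓ') ↦ snoc ℓ' k`
  rw [← (Fin.snocEquiv fun _ : Fin (n + 1) => Fin (w ^ 2)).sum_comp, Fintype.sum_prod_type]
  refine Finset.sum_congr rfl fun k _ => ?_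
  rw [map_sum, Finset.sum_mul]
  refine Finset.sum_congr rfl fun ℓ _ => ?_
  have e : (Fin.snocEquiv fun _ : Fin (n + 1) => Fin (w ^ 2)) (k, ℓ) =
      (Fin.snoc ℓ k : Fin (n + 1) → Fin (w ^ 2)) := rfl
  rw [e, fsIdx_snoc_last, Fin.prod_univ_castSucc, map_mul, map_prod]
  congr 1
  congr 1
  · -- the `n` old `x`-layers
    refine Finset.prod_congr rfl fun j _ => ?_
    have hidx : fsIdx (Fin.snoc ℓ k : Fin (n + 1) → Fin (w ^ 2)) j.castSucc.castSucc =
        fsIdx ℓ j.castSucc := fsIdx_snoc_castSucc ℓ k j.castSucc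
    have harg : fsArg ω (Fin.snoc ℓ k : Fin (n + 1) → Fin (w ^ 2)) j.castSucc =
        MvPolynomial.aeval
          (Fin.snoc (fun j : Fin n => (X j.castSucc.castSucc : MvPolynomial (Fin (n + 2)) F))
            (if (m' : Fin (n + 1) →₀ ℕ) (Fin.last n) = 0 then
                C (ω ^ ((k : ℕ) + 1)) * X (Fin.last n).castSucc
             else (C (ω ^ ((k : ℕ) + 1)) * X (Fin.last n).castSucc) ^ (2 ^ n * d * w ^ 2)))
          (fsArg ω ℓ j) := by
      unfold fsArg
      rw [map_mul, MvPolynomial.algHom_C, aeval_snoc_X_castSucc, Fin.snoc_castSucc,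
        MvPolynomial.algebraMap_eq]
    rw [← hm j, hidx, harg, Fin.val_castSucc]
    split_ifs <;> simp only [← map_pow, Polynomial.aeval_algHom_apply]
  · -- the new last `x`-layer (bit `c`) = the old `p`-layer twisted
    have hidx : fsIdx (Fin.snoc ℓ k : Fin (n + 1) → Fin (w ^ 2)) (Fin.last n).castSucc =
        fsIdx ℓ (Fin.last n) := fsIdx_snoc_castSucc ℓ k (Fin.last n)
    have harg : fsArg ω (Fin.snoc ℓ k : Fin (n + 1) → Fin (w ^ 2)) (Fin.last n) =
        C (ω ^ ((k : ℕ) + 1)) * X (Fin.last n).castSucc := by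
      unfold fsArg
      rw [Fin.snoc_last]
    rw [hidx, harg, Fin.val_last, ← Polynomial.aeval_algHom_apply, MvPolynomial.aeval_X,
      Fin.snoc_last]
    split_ifs <;> rfl

/-! ### Lemma 16 (arXiv; "Bounding the degree"), second bullet: the last seed has degree `≤ w²` -/

/-- `deg_k p(q) ≤ deg(p) · deg_k(q)` for a univariate `p` substituted with a multivariate `q`.
[cite: ForbesShpilka2013, Lemma 16 (arXiv numbering; §3.2), proof ("`deg(p_{ℓ_i}) ≤ r²`")]
locator: paper:arxiv-1209.2408 p0015.txt:L44–L47 -/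
theorem degreeOf_polynomial_aeval_le {σ R : Type*} [CommRing R] (k : σ) (q : MvPolynomial σ R)
    (p : Polynomial R) :
    (Polynomial.aeval q p).degreeOf k ≤ p.natDegree * q.degreeOf k := by
  classical
  rw [Polynomial.aeval_eq_sum_range]
  refine (MvPolynomial.degreeOf_sum_le _ _ _).trans (Finset.sup_le fun i hi => ?_)
  rw [MvPolynomial.smul_eq_C_mul]
  refine (MvPolynomial.degreeOf_mul_le _ _ _).trans ?_
  rw [MvPolynomial.degreeOf_C, zero_add]
  refine (MvPolynomial.degreeOf_pow_le _ _ _).trans ?_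
  exact Nat.mul_le_mul_right _ (Nat.lt_succ_iff.mp (Finset.mem_range.mp hi))

/-- `deg p_ℓ ≤ w²` for all the basis polynomials, "even for `p_{ℓ_{-1}}(t) = t`, as `r ≥ 1`"
(the Lagrange polynomials on `w²` nodes have degree `≤ w² - 1`).
[cite: ForbesShpilka2013, Lemma 16 (arXiv numbering; §3.2), proof] locator: paper:arxiv-1209.2408 p0015.txt:L44 -/
theorem natDegree_fsBasis_le (hw : 0 < w) (β : Fin (w ^ 2) → F) (o : Option (Fin (w ^ 2))) :
    (fsBasis β o).natDegree ≤ w ^ 2 := by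
  classical
  cases o with
  | none =>
    show (Polynomial.X : Polynomial F).natDegree ≤ w ^ 2
    rw [Polynomial.natDegree_X]
    exact Nat.one_le_pow _ _ hw
  | some ℓ =>
    show (Lagrange.basis Finset.univ β ℓ).natDegree ≤ w ^ 2
    unfold Lagrange.basis
    refine (Polynomial.natDegree_prod_le _ _).trans ?_
    have hle : ∑ j ∈ Finset.univ.erase ℓ, (Lagrange.basisDivisor (β ℓ) (β j)).natDegree ≤
        ∑ j ∈ Finset.univ.erase ℓ, (1 : ℕ) := by
      refine Finset.sum_le_sum fun j _ => ?_
      by_cases h : β ℓ = β j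
      · rw [h, Lagrange.natDegree_basisDivisor_self]; exact Nat.zero_le _
      · exact (Lagrange.natDegree_basisDivisor_of_ne h).le
    refine hle.trans ?_
    rw [Finset.sum_const, smul_eq_mul, mul_one]
    exact (Finset.card_erase_le).trans (by rw [Finset.card_univ, Fintype.card_fin])

/-- The `x`-layers of (7.1) do not involve the last seed: `deg_{y_n}` of
`p(ω^{ℓ+1} y_i)` resp. `p((ω^{ℓ+1} y_i)^e)`, `i < n`, is `0`.
[cite: ForbesShpilka2013, Lemma 16 (arXiv numbering; §3.2), proof] locator: paper:arxiv-1209.2408 p0015.txt:L44–L47 -/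
theorem degreeOf_last_aeval_fsArg_pow (ω : F) (ℓ : Fin n → Fin (w ^ 2)) (i : Fin n) (e : ℕ)
    (p : Polynomial F) :
    (Polynomial.aeval (fsArg ω ℓ i ^ e) p).degreeOf (Fin.last n) = 0 := by
  classical
  refine Nat.eq_zero_of_le_zero ((degreeOf_polynomial_aeval_le _ _ _).trans ?_)
  have h0 : (fsArg ω ℓ i).degreeOf (Fin.last n) = 0 := by
    unfold fsArg
    refine Nat.eq_zero_of_le_zero ((MvPolynomial.degreeOf_mul_le _ _ _).trans ?_)
    rw [MvPolynomial.degreeOf_C, zero_add, MvPolynomial.degreeOf_X_of_ne]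
    exact (ne_of_lt (Fin.castSucc_lt_last i)).symm
  have h1 : (fsArg ω ℓ i ^ e).degreeOf (Fin.last n) = 0 :=
    Nat.eq_zero_of_le_zero ((MvPolynomial.degreeOf_pow_le _ _ _).trans (by rw [h0, mul_zero]))
  rw [h1, mul_zero]

/-- **[ForbesShpilka2013, arXiv Lemma 16 "Bounding the degree", second bullet] for FSV's
(7.1):** "For `i = d`, `deg_{α_d}(𝒢_{d,b}(α⃗)) ≤ r²`" — the last seed `y_n` enters
`𝒢^{(n)}_m` only through the factor `p_{ℓ_n}(y_n)`: `deg_{y_n} fsGenCoord n w d ω β m ≤ w²`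
(`w ≥ 1`). This is the degree bound `m = r²` on the curves `f_i, g_i` with which Lemma 3.6
(`FS2013.card_lt_of_not_span_evalProd_le`) is applied in the induction of Lemma 3.19.
[cite: ForbesShpilka2013, Lemma 16 (arXiv numbering; §3.2), second bullet]
locator: paper:arxiv-1209.2408 p0015.txt:L40–L47 -/
theorem degreeOf_last_fsGenCoord_le (hw : 0 < w) (n d : ℕ) (ω : F) (β : Fin (w ^ 2) → F)
    (m : multilinearMonomials n) :
    (fsGenCoord n w d ω β m).degreeOf (Fin.last n) ≤ w ^ 2 := by
  classical
  unfold fsGenCoord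
  refine (MvPolynomial.degreeOf_sum_le _ _ _).trans (Finset.sup_le fun ℓ _ => ?_)
  refine (MvPolynomial.degreeOf_mul_le _ _ _).trans ?_
  have hx : (∏ i : Fin n,
      (if (m : Fin n →₀ ℕ) i = 0 then
        Polynomial.aeval (fsArg ω ℓ i) (fsBasis β (fsIdx ℓ i.castSucc))
       else
        Polynomial.aeval (fsArg ω ℓ i ^ (2 ^ (i : ℕ) * d * w ^ 2))
          (fsBasis β (fsIdx ℓ i.castSucc)))).degreeOf (Fin.last n) = 0 := by
    refine Nat.eq_zero_of_le_zero ((MvPolynomial.degreeOf_prod_le _ _ _).trans ?_)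
    refine (Finset.sum_eq_zero fun i _ => ?_).le
    split_ifs
    · simpa only [pow_one] using degreeOf_last_aeval_fsArg_pow ω ℓ i 1 (fsBasis β (fsIdx ℓ i.castSucc))
    · exact degreeOf_last_aeval_fsArg_pow ω ℓ i _ _
  rw [hx, zero_add]
  refine (degreeOf_polynomial_aeval_le _ _ _).trans ?_
  rw [MvPolynomial.degreeOf_X, if_pos rfl, mul_one]
  exact natDegree_fsBasis_le hw β _

/-! ### The binary split `𝓜 = 𝓜₀ · 𝓜₁` of Lemma 3.19 (arXiv Lemma 19) in FSV's order `X_1, …, X_N` -/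

section BinarySplit

variable {n : ℕ}

/-- Bit `i` of the `j`-th variable in the binary order `X_1, …, X_N` (`N = 2ⁿ`, FSV §7.1): the
`i`-th binary digit of `j`. [cite: ForbesShpilkaVolk2018, §7.1 ("the canonical identification of a
multilinear monomial with an index in `[N]`, say, using the binary representation")]
locator: paper:arxiv-1701.05328 chunk p0024.txt:L1 -/
theorem binaryOrder_apply (n : ℕ) (j : Fin (2 ^ n)) (i : Fin n) :
    ((binaryOrder n j : multilinearMonomials n) : Fin n →₀ ℕ) i = (j : ℕ) / 2 ^ (i : ℕ) % 2 := by
  simp [binaryOrder, multilinearEquivBits]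

/-- `j < 2ⁿ ⇒ j < 2ⁿ⁺¹` (index of the first half). [folklore] -/
private theorem two_pow_lt_two_pow_succ_of_lt {j : ℕ} (hj : j < 2 ^ n) : j < 2 ^ (n + 1) :=
  lt_of_lt_of_le hj (Nat.pow_le_pow_right (by norm_num) (Nat.le_succ n))

/-- `j < 2ⁿ ⇒ 2ⁿ + j < 2ⁿ⁺¹` (index of the second half). [folklore] -/
private theorem two_pow_add_lt_two_pow_succ {j : ℕ} (hj : j < 2 ^ n) : 2 ^ n + j < 2 ^ (n + 1) := by
  rw [pow_succ]; omega

/-- The first half of the order: for `j < 2ⁿ`, the `j`-th variable of level `n+1` is `X_{(b, 0)}`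
with `b` the `j`-th exponent vector of level `n` ("`𝓜 = 𝓜₀ · 𝓜₁`", the layers with last bit
`c = 0` come first). [cite: ForbesShpilka2013, Lemma 19 (arXiv numbering; §3.2), proof ("It follows from definition that `𝓜 = 𝓜₀·𝓜₁`")]
locator: paper:arxiv-1209.2408 p0016.txt:L40 -/
theorem binaryOrder_succ_lower (j : Fin (2 ^ n)) (i : Fin n) :
    ((binaryOrder (n + 1) ⟨j, two_pow_lt_two_pow_succ_of_lt j.isLt⟩ :
        multilinearMonomials (n + 1)) : Fin (n + 1) →₀ ℕ) i.castSucc =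
      ((binaryOrder n j : multilinearMonomials n) : Fin n →₀ ℕ) i := by
  rw [binaryOrder_apply, binaryOrder_apply, Fin.val_castSucc]

/-- … and its last bit is `0`. [cite: ForbesShpilka2013, Lemma 19 (arXiv numbering; §3.2), proof]
locator: paper:arxiv-1209.2408 p0016.txt:L40 -/
theorem binaryOrder_succ_lower_last (j : Fin (2 ^ n)) :
    ((binaryOrder (n + 1) ⟨j, two_pow_lt_two_pow_succ_of_lt j.isLt⟩ :
        multilinearMonomials (n + 1)) : Fin (n + 1) →₀ ℕ) (Fin.last n) = 0 := by
  rw [binaryOrder_apply, Fin.val_last, Fin.val_mk, Nat.div_eq_of_lt j.isLt]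

/-- The second half of the order: the `(2ⁿ + j)`-th variable of level `n+1` is `X_{(b, 1)}` with `b`
the `j`-th exponent vector of level `n`. [cite: ForbesShpilka2013, Lemma 19 (arXiv numbering; §3.2), proof]
locator: paper:arxiv-1209.2408 p0016.txt:L40 -/
theorem binaryOrder_succ_upper (j : Fin (2 ^ n)) (i : Fin n) :
    ((binaryOrder (n + 1) ⟨2 ^ n + j, two_pow_add_lt_two_pow_succ j.isLt⟩ :
        multilinearMonomials (n + 1)) : Fin (n + 1) →₀ ℕ) i.castSucc =
      ((binaryOrder n j : multilinearMonomials n) : Fin n →₀ ℕ) i := by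
  rw [binaryOrder_apply, binaryOrder_apply, Fin.val_castSucc, Fin.val_mk]
  obtain ⟨t, ht⟩ : ∃ t, n = (i : ℕ) + 1 + t := ⟨n - (i + 1), by have := i.isLt; omega⟩
  have key : ∀ a t b : ℕ, (2 ^ (a + 1 + t) + b) / 2 ^ a % 2 = b / 2 ^ a % 2 := by
    intro a t b
    have hpow : 2 ^ (a + 1 + t) = 2 ^ a * (2 * 2 ^ t) := by
      rw [pow_add, pow_add, pow_one, mul_assoc]
    rw [hpow, Nat.mul_add_div (by positivity)]
    omega
  have h := key (i : ℕ) t (j : ℕ)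
  rw [← ht] at h
  exact h

/-- … and its last bit is `1`. [cite: ForbesShpilka2013, Lemma 19 (arXiv numbering; §3.2), proof]
locator: paper:arxiv-1209.2408 p0016.txt:L40 -/
theorem binaryOrder_succ_upper_last (j : Fin (2 ^ n)) :
    ((binaryOrder (n + 1) ⟨2 ^ n + j, two_pow_add_lt_two_pow_succ j.isLt⟩ :
        multilinearMonomials (n + 1)) : Fin (n + 1) →₀ ℕ) (Fin.last n) = 1 := by
  rw [binaryOrder_apply, Fin.val_last, Fin.val_mk]
  have hpos : 0 < 2 ^ n := Nat.pos_of_ne_zero (by positivity)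
  rw [show 2 ^ n + (j : ℕ) = 2 ^ n * 1 + j by rw [mul_one], Nat.mul_add_div hpos,
    Nat.div_eq_of_lt j.isLt]

/-- The ordered product of `2^{n+1}` layers is (first `2ⁿ` layers) · (last `2ⁿ` layers).
[cite: ForbesShpilka2013, Lemma 19 (arXiv numbering; §3.2), proof ("`𝓜 = 𝓜₀ · 𝓜₁`")]
locator: paper:arxiv-1209.2408 p0016.txt:L40 -/
theorem listProd_ofFn_two_pow_succ {α : Type*} [Monoid α] (M : Fin (2 ^ (n + 1)) → α) :
    (List.ofFn M).prod =
      (List.ofFn fun j : Fin (2 ^ n) => M ⟨j, two_pow_lt_two_pow_succ_of_lt j.isLt⟩).prod *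
        (List.ofFn fun j : Fin (2 ^ n) => M ⟨2 ^ n + j, two_pow_add_lt_two_pow_succ j.isLt⟩).prod := by
  have h : 2 ^ (n + 1) = 2 ^ n + 2 ^ n := by rw [pow_succ]; ring
  rw [List.ofFn_congr h M, List.ofFn_add, List.prod_append]
  rfl

end BinarySplit

/-! ### Evaluating the recursion: the curve through the `w²` evaluation points (nodes `β_ℓ`) -/

section Nodes

/-- Evaluating a univariate polynomial substituted with a multivariate one. [folklore] -/
private theorem eval_polynomial_aeval' {σ : Type*} (x : σ → F) (q : MvPolynomial σ F)
    (p : Polynomial F) : MvPolynomial.eval x (Polynomial.aeval q p) = p.eval (MvPolynomial.eval x q) := by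
  rw [Polynomial.aeval_eq_sum_range, Polynomial.eval_eq_sum_range, map_sum]
  refine Finset.sum_congr rfl fun k _ => ?_
  rw [MvPolynomial.smul_eval, map_pow]

/-- `p_k(β_ℓ) = [k = ℓ]` for the Lagrange polynomials at distinct nodes (Def. 3.4 / arXiv Def. 11:
"the unique polynomials `p_ℓ` of degree `< s` such that `p_ℓ(β_i) = 𝟙_{i=ℓ}`").
[cite: ForbesShpilka2013, Definition 11 (arXiv numbering; §3.1)] locator: paper:arxiv-1209.2408 p0014.txt:L21–L22 -/
theorem eval_fsBasis_some (β : Fin (w ^ 2) → F) (hβ : Function.Injective β) (k ℓ : Fin (w ^ 2)) :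
    (fsBasis β (some k)).eval (β ℓ) = if k = ℓ then 1 else 0 := by
  classical
  show (Lagrange.basis Finset.univ β k).eval (β ℓ) = _
  split_ifs with h
  · subst h
    exact Lagrange.eval_basis_self (hβ.injOn.mono (Set.subset_univ _)) (Finset.mem_univ _)
  · exact Lagrange.eval_basis_of_ne h (Finset.mem_univ _)

/-- **The curve of level `n+1` passes through the twisted evaluation points of level `n`** (the
use of Lemma 17 in the proof of Lemma 19: "rewriting this via Lemma 17",
`U(β_ℓ) = R(ω^ℓ α̂)`, `V(β_ℓ) = T((ω^ℓ α̂)^{Dnr²/2})`): at the node `y_{n+1} = β_ℓ`,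
`𝒢^{(n+1)}_{m'}(α', a, β_ℓ) = 𝒢^{(n)}_{m}(α', ω^{ℓ+1} a)` if the last bit `c = 0`, resp.
`= 𝒢^{(n)}_{m}(α', (ω^{ℓ+1} a)^{2ⁿ d w²})` if `c = 1`.
[cite: ForbesShpilka2013, Lemma 19 (arXiv numbering; §3.2), proof (last display, "rewriting this via Lemma 17"); Lemma 12 (arXiv), proof ("`U(β_ℓ) = R(ω^ℓα)` and `V(β_ℓ) = T((ω^ℓα)^{Dnm})`")]
locator: paper:arxiv-1209.2408 p0016.txt:L55–L60; p0014.txt:L40–L41 -/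
theorem eval_fsGenCoord_succ_node (n w d : ℕ) (ω : F) (β : Fin (w ^ 2) → F)
    (hβ : Function.Injective β) (m' : multilinearMonomials (n + 1)) (m : multilinearMonomials n)
    (hm : ∀ i : Fin n, (m : Fin n →₀ ℕ) i = (m' : Fin (n + 1) →₀ ℕ) i.castSucc)
    (α' : Fin n → F) (a : F) (ℓ : Fin (w ^ 2)) :
    MvPolynomial.eval (Fin.snoc (Fin.snoc α' a : Fin (n + 1) → F) (β ℓ))
        (fsGenCoord (n + 1) w d ω β m') =
      MvPolynomial.eval
        (Fin.snoc α' (if (m' : Fin (n + 1) →₀ ℕ) (Fin.last n) = 0 then ω ^ ((ℓ : ℕ) + 1) * a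
          else (ω ^ ((ℓ : ℕ) + 1) * a) ^ (2 ^ n * d * w ^ 2)))
        (fsGenCoord n w d ω β m) := by
  classical
  rw [fsGenCoord_succ n w d ω β m' m hm, map_sum]
  -- the substitution followed by the evaluation is the evaluation at the twisted point
  have hsub : ∀ k : Fin (w ^ 2),
      MvPolynomial.eval (Fin.snoc (Fin.snoc α' a : Fin (n + 1) → F) (β ℓ))
        (MvPolynomial.aeval
          (Fin.snoc (fun j : Fin n => (X j.castSucc.castSucc : MvPolynomial (Fin (n + 2)) F))
            (if (m' : Fin (n + 1) →₀ ℕ) (Fin.last n) = 0 then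
                C (ω ^ ((k : ℕ) + 1)) * X (Fin.last n).castSucc
             else (C (ω ^ ((k : ℕ) + 1)) * X (Fin.last n).castSucc) ^ (2 ^ n * d * w ^ 2)))
          (fsGenCoord n w d ω β m)) =
      MvPolynomial.eval
        (Fin.snoc α' (if (m' : Fin (n + 1) →₀ ℕ) (Fin.last n) = 0 then ω ^ ((k : ℕ) + 1) * a
          else (ω ^ ((k : ℕ) + 1) * a) ^ (2 ^ n * d * w ^ 2)))
        (fsGenCoord n w d ω β m) := by
    intro k
    rw [MvPolynomial.aeval_eq_bind₁]
    show MvPolynomial.eval₂Hom (RingHom.id F) _ (MvPolynomial.bind₁ _ _) =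
      MvPolynomial.eval₂Hom (RingHom.id F) _ _
    rw [MvPolynomial.eval₂Hom_bind₁]
    congr 2
    funext i
    refine Fin.lastCases ?_ (fun j => ?_) i
    · simp only [Fin.snoc_last]
      have hX : MvPolynomial.eval₂Hom (RingHom.id F)
          (Fin.snoc (Fin.snoc α' a : Fin (n + 1) → F) (β ℓ)) (X (Fin.last n).castSucc) = a := by
        rw [MvPolynomial.eval₂Hom_X', Fin.snoc_castSucc, Fin.snoc_last]
      split_ifs
      · rw [map_mul, MvPolynomial.eval₂Hom_C, RingHom.id_apply, hX]
      · rw [map_pow, map_mul, MvPolynomial.eval₂Hom_C, RingHom.id_apply, hX]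
    · rw [Fin.snoc_castSucc, Fin.snoc_castSucc, MvPolynomial.eval₂Hom_X', Fin.snoc_castSucc,
        Fin.snoc_castSucc]
  simp_rw [map_mul, hsub, eval_polynomial_aeval', MvPolynomial.eval_X, Fin.snoc_last,
    eval_fsBasis_some β hβ, mul_ite, mul_one, mul_zero]
  rw [Finset.sum_ite_eq' Finset.univ ℓ, if_pos (Finset.mem_univ _)]

end Nodes

/-! ### The last seed as a curve parameter; layer products (tools for Lemma 3.19's induction) -/

section Curves

variable {r : ℕ}

/-- Specialising all seeds but the last to constants `α'` and the last to the indeterminate gives a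
univariate polynomial whose values are the evaluations at `(α', s)` ("the matrices in each of
`𝓜'_c` are parameterized only by the variable `α_{d-1}` … each … of the form `M(f(α_{d-1}))` for
… `f ∈ 𝔽[α_{d-1}]`"). [cite: ForbesShpilka2013, Lemma 19 (arXiv numbering; §3.2), proof]
locator: paper:arxiv-1209.2408 p0016.txt:L51–L53 -/
theorem eval_aeval_snoc_C_X {n : ℕ} (α' : Fin n → F) (f : MvPolynomial (Fin (n + 1)) F) (s : F) :
    (MvPolynomial.aeval (Fin.snoc (fun i : Fin n => Polynomial.C (α' i)) Polynomial.X :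
        Fin (n + 1) → Polynomial F) f).eval s = MvPolynomial.eval (Fin.snoc α' s) f := by
  induction f using MvPolynomial.induction_on with
  | C a => simp
  | add p q hp hq => rw [map_add, Polynomial.eval_add, hp, hq, map_add]
  | mul_X p i hp =>
    rw [map_mul, Polynomial.eval_mul, hp, map_mul, MvPolynomial.aeval_X, MvPolynomial.eval_X]
    congr 1
    refine Fin.lastCases ?_ (fun j => ?_) i
    · rw [Fin.snoc_last, Fin.snoc_last, Polynomial.eval_X]
    · rw [Fin.snoc_castSucc, Fin.snoc_castSucc, Polynomial.eval_C]

/-- … and its degree is at most the degree of `f` in the last seed.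
[cite: ForbesShpilka2013, Lemma 19 (arXiv numbering; §3.2), proof ("`f ∈ 𝔽[α_{d-1}]` of degree
`≤ r²` (where the degree bound is by Lemma 16)")] locator: paper:arxiv-1209.2408 p0016.txt:L52–L53 -/
theorem natDegree_aeval_snoc_C_X_le {n : ℕ} (α' : Fin n → F) (f : MvPolynomial (Fin (n + 1)) F) :
    (MvPolynomial.aeval (Fin.snoc (fun i : Fin n => Polynomial.C (α' i)) Polynomial.X :
        Fin (n + 1) → Polynomial F) f).natDegree ≤ f.degreeOf (Fin.last n) := by
  classical
  conv_lhs => rw [f.as_sum]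
  rw [map_sum]
  refine Polynomial.natDegree_sum_le_of_forall_le _ _ fun v hv => ?_
  rw [MvPolynomial.aeval_monomial, Polynomial.algebraMap_eq]
  refine Polynomial.natDegree_mul_le.trans ?_
  rw [Polynomial.natDegree_C, zero_add, Finsupp.prod]
  refine (Polynomial.natDegree_prod_le _ _).trans ?_
  have hv' : v (Fin.last n) ≤ f.degreeOf (Fin.last n) :=
    MvPolynomial.degreeOf_le_iff.mp le_rfl v hv
  refine (Finset.sum_le_sum (g := fun i => if i = Fin.last n then v i else 0) fun i _ => ?_).trans ?_
  · refine Fin.lastCases ?_ (fun j => ?_) i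
    · rw [if_pos rfl, Fin.snoc_last, Polynomial.natDegree_X_pow]
    · rw [if_neg (ne_of_lt (Fin.castSucc_lt_last j)), Fin.snoc_castSucc, ← Polynomial.C_pow,
        Polynomial.natDegree_C]
  · rw [Finset.sum_ite_eq']
    split_ifs
    · exact hv'
    · exact Nat.zero_le _

/-- The curve `s ↦ 𝒢^{(n)}_m(α', s)` in the last seed, as a univariate polynomial, has degree
`≤ w²` (arXiv Lemma 16, second bullet, in the form used by Lemma 19: "`f` of degree `≤ r²`").
[cite: ForbesShpilka2013, Lemma 16 and Lemma 19 (arXiv numbering; §3.2)]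
locator: paper:arxiv-1209.2408 p0016.txt:L52–L53 -/
theorem natDegree_fsGenCoord_lastCurve_le (hw : 0 < w) (n d : ℕ) (ω : F) (β : Fin (w ^ 2) → F)
    (m : multilinearMonomials n) (α' : Fin n → F) :
    (MvPolynomial.aeval (Fin.snoc (fun i : Fin n => Polynomial.C (α' i)) Polynomial.X :
        Fin (n + 1) → Polynomial F) (fsGenCoord n w d ω β m)).natDegree ≤ w ^ 2 :=
  (natDegree_aeval_snoc_C_X_le α' _).trans (degreeOf_last_fsGenCoord_le hw n d ω β m)

/-- Entries of an ordered product of `k` layers of degree `≤ e` have degree `≤ k e`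
("`R ∈ 𝔽[x]^{r×r}` is of degree `< Dnm`"). [cite: ForbesShpilka2013, Lemma 12 (arXiv numbering; §3.1), proof (first line)]
locator: paper:arxiv-1209.2408 p0014.txt:L29–L30 -/
theorem natDegree_listProd_ofFn_le {R : Type*} [CommRing R] :
    ∀ (k : ℕ) (N : Fin k → Matrix (Fin r) (Fin r) (Polynomial R)) (e : ℕ),
      (∀ i a b, (N i a b).natDegree ≤ e) → ∀ a b, ((List.ofFn N).prod a b).natDegree ≤ k * e := by
  intro k
  induction k with
  | zero =>
    intro N e _ a b
    rw [List.ofFn_zero, List.prod_nil, zero_mul]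
    by_cases h : a = b
    · subst h; rw [Matrix.one_apply_eq, Polynomial.natDegree_one]
    · rw [Matrix.one_apply_ne h, Polynomial.natDegree_zero]
  | succ k ih =>
    intro N e hN a b
    rw [List.ofFn_succ, List.prod_cons, Matrix.mul_apply]
    refine Polynomial.natDegree_sum_le_of_forall_le _ _ fun c _ => ?_
    refine Polynomial.natDegree_mul_le.trans ?_
    have h1 := hN 0 a c
    have h2 := ih (fun i => N i.succ) e (fun i => hN i.succ) c b
    rw [Nat.succ_mul]
    omega

/-- A ring homomorphism (evaluation, composition with a curve) maps an ordered layer product to the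
ordered product of the mapped layers. [cite: ForbesShpilka2013, Lemma 12 (arXiv numbering; §3.1), proof ("Define `R(x) = ∏_i M_i(f_i(x))`")]
locator: paper:arxiv-1209.2408 p0014.txt:L29 -/
theorem map_listProd_ofFn {R S : Type*} [CommRing R] [CommRing S] (f : R →+* S) {k : ℕ}
    (N : Fin k → Matrix (Fin r) (Fin r) R) :
    ((List.ofFn N).prod).map f = (List.ofFn fun i => (N i).map f).prod := by
  have h := map_list_prod (RingHom.mapMatrix f : Matrix (Fin r) (Fin r) R →+* Matrix (Fin r) (Fin r) S)
    (List.ofFn N)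
  rw [RingHom.mapMatrix_apply, List.map_ofFn] at h
  exact h

/-- Evaluating a layer composed with a curve: `(M ∘ q)(x) = M(q(x))`.
[cite: ForbesShpilka2013, Lemma 12 (arXiv numbering; §3.1), statement ("`M_i(f_i(x))`")]
locator: paper:arxiv-1209.2408 p0014.txt:L23 -/
theorem map_comp_map_eval {R : Type*} [CommRing R] {m m' : Type*} (M : Matrix m m' (Polynomial R))
    (q : Polynomial R) (x : R) :
    (M.map fun p => p.comp q).map (Polynomial.eval x) = M.map (Polynomial.eval (q.eval x)) := by
  ext a b
  simp only [Matrix.map_apply, Polynomial.eval_comp]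

/-- … and its degree: `deg (p ∘ q) ≤ deg p · deg q` entrywise (Mathlib `natDegree_comp_le`).
[cite: ForbesShpilka2013, Lemma 12 (arXiv numbering; §3.1), proof] locator: paper:arxiv-1209.2408 p0014.txt:L29–L30 -/
theorem natDegree_map_comp_le {R : Type*} [CommRing R] [NoZeroDivisors R] {m m' : Type*}
    (M : Matrix m m' (Polynomial R))
    (q : Polynomial R) {dM dq : ℕ} (hM : ∀ a b, (M a b).natDegree ≤ dM) (hq : q.natDegree ≤ dq)
    (a : m) (b : m') : ((M.map fun p => p.comp q) a b).natDegree ≤ dM * dq := by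
  rw [Matrix.map_apply]
  refine Polynomial.natDegree_comp_le.trans ?_
  exact Nat.mul_le_mul (hM a b) hq

end Curves

end FS2013

end Literature.Computability.AlgebraicComplexity
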